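import Literature.Analysis.FluidPDE.TaoCascadeODE

/-!
# Crux `PerpetualPump.AveragedTypeIBlowup` (stmt-NavierStokesRegularity-1835), line `Sketch`:
# tools for the stub `chainContinuation` — weighted estimates for the circuit nonlinearity and the
# weight bootstrap of a bounded solution of the Volterra chain

T. Tao, *Finite time blowup for an averaged three-dimensional Navier–Stokes equation*, J. Amer.
Math. Soc. **29** (2016), 601–674 = arXiv:1402.0290v3, §4, (4.8) and p. 22 (4.14): pairing the
wavelet Duhamel formula (4.14) with `ψ_{i,n}` gives the exact Volterra chain of the coefficients,
`Y_{i,n}(t) = A 1_{(i,n)=(i₀,n₀)} k_{i,n}(t) + ∫₀ᵗ k_{i,n}(t-s) quadTerm(Y)_{i,n}(s) ds`, `|k_{i,n}| ≤ 1`.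

Helper file (theorems only) for the registered stub `stub_chainContinuation` of the lead's skeleton
`Cruxes/AveragedTypeIBlowup/Lines/Sketch.lean`: elementary bookkeeping for the accepted nonlinearity
`TaoCascade.quadTerm` in the scale weights `(1+ε₀)^{wn}` — size and Lipschitz bounds
(`abs_quadTerm_le_of_weight`, `abs_quadTerm_sub_le_of_weight`: weighted size `C` at weight `w ≥ 5/4`
gives a drive of size `K C² (1+ε₀)^{(2w-5/2)(1-n)}` at scale `n`), the same bounds integrated against
a kernel `|g| ≤ 1` in the weight `(1+ε₀)^{20n}` (`weighted_volterra_sub_le`, `weighted_volterra_abs_le`),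
no drive below the lowest populated scale, and the registered sub-goal this file lands,
`stub_chainContinuationBootstrap`: a solution of the chain on `[0,S)` with no modes below `n₀`,
bounded in the weight `(1+ε₀)^{wn}` uniformly on `[0,S)`, is bounded in every weight
`(1+ε₀)^{w'n}`, `w' ≤ 2w - 5/2`, uniformly on `[0,S)` (one Duhamel iteration).

Nothing here closes the item (`--supports`); no statement of the route changes.

## References

* T. Tao, J. Amer. Math. Soc. 29 (2016), 601–674, arXiv:1402.0290v3, §4 (4.8), p. 22 (4.14).
  [`Tao2016AveragedNS`]
-/

noncomputable section

-- the summit namespace `…NavierStokesRegularity.NavierStokesRegularity…` is the tree convention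
set_option linter.dupNamespace false

open MeasureTheory Set Filter Topology
open scoped ENNReal
open Literature.Analysis.FluidPDE
open Literature.Analysis.FluidPDE.TaoCascade (quadTerm shiftSet mem_shiftSet_iff)

namespace Summit.NavierStokesRegularity.NavierStokesRegularity.Theorems.PerpetualPumpAveragedTypeIBlowup

variable {ε₀ : ℝ} {m : ℕ}

/-! ### Weights -/

/-- Passing a scale weight across an inequality: `L^e |x| ≤ ρ ↔ |x| ≤ ρ L^{-e}`. [folklore] -/
theorem weight_mul_abs_le_iff (hL : 0 < 1 + ε₀) (e ρ x : ℝ) :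
    (1 + ε₀) ^ e * |x| ≤ ρ ↔ |x| ≤ ρ * (1 + ε₀) ^ (-e) := by
  rw [Real.rpow_neg hL.le, ← div_eq_mul_inv, le_div_iff₀ (Real.rpow_pos_of_pos hL _), mul_comm]

/-- On the shift set `S = {(0,0,0),(1,0,0),(0,1,0),(0,0,1)}`: `μ₁, μ₂, μ₃ ≥ 0`, `μ₃ ≤ 1`, and one of
`μ₁`, `μ₂` vanishes. [cite: Tao2016AveragedNS, §4 after (4.1)] -/
theorem shiftSet_mem_bounds {μ : ℤ × ℤ × ℤ} (hμ : μ ∈ shiftSet) :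
    0 ≤ μ.1 ∧ 0 ≤ μ.2.1 ∧ 0 ≤ μ.2.2 ∧ μ.2.2 ≤ 1 ∧ (μ.1 = 0 ∨ μ.2.1 = 0) := by
  rcases (mem_shiftSet_iff μ).1 hμ with rfl | rfl | rfl | rfl <;> simp

/-- The exponent bookkeeping of one monomial of `quadTerm_{i,n}` in the weight `(1+ε₀)^{wn}`,
`w ≥ 5/4`: `(1+ε₀)^{5(n-μ₃)/2} (1+ε₀)^{-w(n-μ₃+μ₁)} (1+ε₀)^{-w(n-μ₃+μ₂)} ≤ (1+ε₀)^{(2w-5/2)(1-n)}`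
for `μ ∈ S`. [folklore] -/
theorem rpow_shift_mul_le (hε₀ : 0 < ε₀) {w : ℝ} (hw : 5 / 4 ≤ w) {μ : ℤ × ℤ × ℤ} (hμ : μ ∈ shiftSet)
    (n : ℤ) :
    (1 + ε₀) ^ ((5 : ℝ) * (n - μ.2.2) / 2) *
        ((1 + ε₀) ^ (-(w * (n - μ.2.2 + μ.1 : ℤ))) * (1 + ε₀) ^ (-(w * (n - μ.2.2 + μ.2.1 : ℤ)))) ≤
      (1 + ε₀) ^ ((2 * w - 5 / 2) * (1 - n)) := by
  have hL0 : 0 < 1 + ε₀ := by linarith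
  obtain ⟨h1, h2, h3, h4, -⟩ := shiftSet_mem_bounds hμ
  rw [← Real.rpow_add hL0, ← Real.rpow_add hL0]
  refine Real.rpow_le_rpow_of_exponent_le (by linarith) ?_
  have f1 : (0 : ℝ) ≤ μ.1 := by exact_mod_cast h1
  have f2 : (0 : ℝ) ≤ μ.2.1 := by exact_mod_cast h2
  have f4 : (μ.2.2 : ℝ) ≤ 1 := by exact_mod_cast h4
  have p1 : 0 ≤ (2 * w - 5 / 2) * (1 - (μ.2.2 : ℝ)) := mul_nonneg (by linarith) (by linarith)
  have p2 : 0 ≤ w * (μ.1 : ℝ) := mul_nonneg (by linarith) f1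
  have p3 : 0 ≤ w * (μ.2.1 : ℝ) := mul_nonneg (by linarith) f2
  push_cast
  nlinarith [p1, p2, p3]

/-! ### The circuit nonlinearity in a scale weight -/

/-- The difference of one monomial of the drive at two coefficient families of weighted size `ρ`
and weighted distance `D` (weight `(1+ε₀)^{wk}`, `w ≥ 5/4`):
`|a (1+ε₀)^{5(n-μ₃)/2} (X X - X' X')| ≤ |a| (2ρD) (1+ε₀)^{(2w-5/2)(1-n)}`. [cite: Tao2016AveragedNS, §4 (4.8)] -/
theorem abs_quadMonomial_sub_le (hε₀ : 0 < ε₀) {w : ℝ} (hw : 5 / 4 ≤ w) {ρ D : ℝ} (hρ : 0 ≤ ρ)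
    (hD : 0 ≤ D) {X X' : Fin m → ℤ → ℝ → ℝ} {s : ℝ}
    (hX : ∀ (j : Fin m) (k : ℤ), |X j k s| ≤ ρ * (1 + ε₀) ^ (-(w * k)))
    (hX' : ∀ (j : Fin m) (k : ℤ), |X' j k s| ≤ ρ * (1 + ε₀) ^ (-(w * k)))
    (hd : ∀ (j : Fin m) (k : ℤ), |X j k s - X' j k s| ≤ D * (1 + ε₀) ^ (-(w * k)))
    (a : ℝ) {μ : ℤ × ℤ × ℤ} (hμ : μ ∈ shiftSet) (i₁ i₂ : Fin m) (n : ℤ) :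
    |a * (1 + ε₀) ^ ((5 : ℝ) * (n - μ.2.2) / 2) *
          (X i₁ (n - μ.2.2 + μ.1) s * X i₂ (n - μ.2.2 + μ.2.1) s) -
        a * (1 + ε₀) ^ ((5 : ℝ) * (n - μ.2.2) / 2) *
          (X' i₁ (n - μ.2.2 + μ.1) s * X' i₂ (n - μ.2.2 + μ.2.1) s)| ≤
      |a| * (2 * ρ * D) * (1 + ε₀) ^ ((2 * w - 5 / 2) * (1 - n)) := by
  have hL0 : 0 < 1 + ε₀ := by linarith
  rw [← mul_sub, abs_mul, abs_mul, abs_of_pos (Real.rpow_pos_of_pos hL0 _)]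
  have hsplit : X i₁ (n - μ.2.2 + μ.1) s * X i₂ (n - μ.2.2 + μ.2.1) s -
      X' i₁ (n - μ.2.2 + μ.1) s * X' i₂ (n - μ.2.2 + μ.2.1) s =
      (X i₁ (n - μ.2.2 + μ.1) s - X' i₁ (n - μ.2.2 + μ.1) s) * X i₂ (n - μ.2.2 + μ.2.1) s +
        X' i₁ (n - μ.2.2 + μ.1) s * (X i₂ (n - μ.2.2 + μ.2.1) s - X' i₂ (n - μ.2.2 + μ.2.1) s) := by
    ring
  have h1 : |(X i₁ (n - μ.2.2 + μ.1) s - X' i₁ (n - μ.2.2 + μ.1) s) * X i₂ (n - μ.2.2 + μ.2.1) s| ≤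
      D * (1 + ε₀) ^ (-(w * (n - μ.2.2 + μ.1 : ℤ))) * (ρ * (1 + ε₀) ^ (-(w * (n - μ.2.2 + μ.2.1 : ℤ)))) := by
    rw [abs_mul]
    exact mul_le_mul (hd _ _) (hX _ _) (abs_nonneg _) (by positivity)
  have h2 : |X' i₁ (n - μ.2.2 + μ.1) s * (X i₂ (n - μ.2.2 + μ.2.1) s - X' i₂ (n - μ.2.2 + μ.2.1) s)| ≤
      ρ * (1 + ε₀) ^ (-(w * (n - μ.2.2 + μ.1 : ℤ))) * (D * (1 + ε₀) ^ (-(w * (n - μ.2.2 + μ.2.1 : ℤ)))) := by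
    rw [abs_mul]
    exact mul_le_mul (hX' _ _) (hd _ _) (abs_nonneg _) (by positivity)
  rw [hsplit]
  calc |a| * (1 + ε₀) ^ ((5 : ℝ) * (n - μ.2.2) / 2) *
        |(X i₁ (n - μ.2.2 + μ.1) s - X' i₁ (n - μ.2.2 + μ.1) s) * X i₂ (n - μ.2.2 + μ.2.1) s +
          X' i₁ (n - μ.2.2 + μ.1) s * (X i₂ (n - μ.2.2 + μ.2.1) s - X' i₂ (n - μ.2.2 + μ.2.1) s)|
      ≤ |a| * (1 + ε₀) ^ ((5 : ℝ) * (n - μ.2.2) / 2) *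
          (D * (1 + ε₀) ^ (-(w * (n - μ.2.2 + μ.1 : ℤ))) * (ρ * (1 + ε₀) ^ (-(w * (n - μ.2.2 + μ.2.1 : ℤ)))) +
            ρ * (1 + ε₀) ^ (-(w * (n - μ.2.2 + μ.1 : ℤ))) * (D * (1 + ε₀) ^ (-(w * (n - μ.2.2 + μ.2.1 : ℤ))))) :=
        mul_le_mul_of_nonneg_left ((abs_add_le _ _).trans (add_le_add h1 h2)) (by positivity)
    _ = |a| * (2 * ρ * D) * ((1 + ε₀) ^ ((5 : ℝ) * (n - μ.2.2) / 2) *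
          ((1 + ε₀) ^ (-(w * (n - μ.2.2 + μ.1 : ℤ))) *
            (1 + ε₀) ^ (-(w * (n - μ.2.2 + μ.2.1 : ℤ))))) := by ring
    _ ≤ |a| * (2 * ρ * D) * (1 + ε₀) ^ ((2 * w - 5 / 2) * (1 - n)) :=
        mul_le_mul_of_nonneg_left (rpow_shift_mul_le hε₀ hw hμ n) (by positivity)

/-- **Lipschitz bound for the drive in a weight** (`w ≥ 5/4`): for two families of weighted size
`ρ` at weighted distance `D`,
`|quadTerm_{i,n}(X)(s) - quadTerm_{i,n}(X')(s)| ≤ (Σ_{i₁,i₂,μ}|α_{i₁,i₂,i,μ}|) (2ρD) (1+ε₀)^{(2w-5/2)(1-n)}`. [cite: Tao2016AveragedNS, §4 (4.8)] -/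
theorem abs_quadTerm_sub_le_of_weight (hε₀ : 0 < ε₀) {w : ℝ} (hw : 5 / 4 ≤ w)
    (α : Fin m → Fin m → Fin m → ℤ × ℤ × ℤ → ℝ) {ρ D : ℝ} (hρ : 0 ≤ ρ) (hD : 0 ≤ D)
    {X X' : Fin m → ℤ → ℝ → ℝ} {s : ℝ}
    (hX : ∀ (j : Fin m) (k : ℤ), |X j k s| ≤ ρ * (1 + ε₀) ^ (-(w * k)))
    (hX' : ∀ (j : Fin m) (k : ℤ), |X' j k s| ≤ ρ * (1 + ε₀) ^ (-(w * k)))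
    (hd : ∀ (j : Fin m) (k : ℤ), |X j k s - X' j k s| ≤ D * (1 + ε₀) ^ (-(w * k))) (i : Fin m)
    (n : ℤ) :
    |quadTerm ε₀ α X i n s - quadTerm ε₀ α X' i n s| ≤
      (∑ i₁ : Fin m, ∑ i₂ : Fin m, ∑ μ ∈ shiftSet, |α i₁ i₂ i μ|) * (2 * ρ * D) *
        (1 + ε₀) ^ ((2 * w - 5 / 2) * (1 - n)) := by
  unfold quadTerm
  rw [← Finset.sum_sub_distrib]
  refine (Finset.abs_sum_le_sum_abs _ _).trans ?_
  rw [Finset.sum_mul, Finset.sum_mul]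
  refine Finset.sum_le_sum fun i₁ _ => ?_
  rw [← Finset.sum_sub_distrib]
  refine (Finset.abs_sum_le_sum_abs _ _).trans ?_
  rw [Finset.sum_mul, Finset.sum_mul]
  refine Finset.sum_le_sum fun i₂ _ => ?_
  rw [← Finset.sum_sub_distrib]
  refine (Finset.abs_sum_le_sum_abs _ _).trans ?_
  rw [Finset.sum_mul, Finset.sum_mul]
  exact Finset.sum_le_sum fun μ hμ => abs_quadMonomial_sub_le hε₀ hw hρ hD hX hX' hd _ hμ i₁ i₂ n

/-- **Size of the drive in a weight** (`w ≥ 5/4`): if `|X_{j,k}(s)| ≤ C(1+ε₀)^{-wk}` for all modes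
then `|quadTerm_{i,n}(X)(s)| ≤ (Σ_{i₁,i₂,μ}|α_{i₁,i₂,i,μ}|) (2C·C) (1+ε₀)^{(2w-5/2)(1-n)}` (the Lipschitz
bound against the zero family). [cite: Tao2016AveragedNS, §4 (4.8)] -/
theorem abs_quadTerm_le_of_weight (hε₀ : 0 < ε₀) {w : ℝ} (hw : 5 / 4 ≤ w)
    (α : Fin m → Fin m → Fin m → ℤ × ℤ × ℤ → ℝ) {C : ℝ} (hC : 0 ≤ C) {X : Fin m → ℤ → ℝ → ℝ}
    {s : ℝ} (hX : ∀ (j : Fin m) (k : ℤ), |X j k s| ≤ C * (1 + ε₀) ^ (-(w * k))) (i : Fin m)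
    (n : ℤ) :
    |quadTerm ε₀ α X i n s| ≤
      (∑ i₁ : Fin m, ∑ i₂ : Fin m, ∑ μ ∈ shiftSet, |α i₁ i₂ i μ|) * (2 * C * C) *
        (1 + ε₀) ^ ((2 * w - 5 / 2) * (1 - n)) := by
  have h := abs_quadTerm_sub_le_of_weight hε₀ hw α hC hC hX (X' := fun _ _ _ => 0)
    (fun j k => by rw [abs_zero]; positivity) (fun j k => by rw [sub_zero]; exact hX j k) i n
  have h0 : quadTerm ε₀ α (fun _ _ _ => (0 : ℝ)) i n s = 0 := by simp [quadTerm]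
  rwa [h0, sub_zero] at h

/-- **No drive below the lowest populated scale**: if `Y_{j,k} ≡ 0` for `k < n₀` then
`quadTerm_{i,n}(Y) ≡ 0` for `n < n₀` (every monomial has a factor at a scale `≤ n`). [cite: Tao2016AveragedNS, §4 (4.8)] -/
theorem quadTerm_eq_zero_of_lt (α : Fin m → Fin m → Fin m → ℤ × ℤ × ℤ → ℝ) {Y : Fin m → ℤ → ℝ → ℝ}
    {n₀ : ℤ} (hlow : ∀ i n t, n < n₀ → Y i n t = 0) (i : Fin m) {n : ℤ} (hn : n < n₀) (s : ℝ) :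
    quadTerm ε₀ α Y i n s = 0 := by
  unfold quadTerm
  refine Finset.sum_eq_zero fun i₁ _ => Finset.sum_eq_zero fun i₂ _ =>
    Finset.sum_eq_zero fun μ hμ => ?_
  obtain ⟨-, -, h3, -, h5 | h5⟩ := shiftSet_mem_bounds hμ
  · exact mul_eq_zero_of_right _ (mul_eq_zero_of_left (hlow _ _ _ (by omega)) _)
  · exact mul_eq_zero_of_right _ (mul_eq_zero_of_right _ (hlow _ _ _ (by omega)))

/-- `quadTerm_{i,n}` only reads the coefficient family at the evaluation time. [folklore] -/
theorem quadTerm_congr_at (α : Fin m → Fin m → Fin m → ℤ × ℤ × ℤ → ℝ) {X X' : Fin m → ℤ → ℝ → ℝ}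
    {s : ℝ} (h : ∀ (j : Fin m) (k : ℤ), X j k s = X' j k s) (i : Fin m) (n : ℤ) :
    quadTerm ε₀ α X i n s = quadTerm ε₀ α X' i n s := by
  unfold quadTerm
  simp only [h]

/-- The drive is continuous when all coefficients are. [folklore] -/
theorem continuous_quadTerm (α : Fin m → Fin m → Fin m → ℤ × ℤ × ℤ → ℝ) {X : Fin m → ℤ → ℝ → ℝ}
    (hX : ∀ j k, Continuous (X j k)) (i : Fin m) (n : ℤ) :
    Continuous fun s => quadTerm ε₀ α X i n s := by
  unfold quadTerm
  refine continuous_finsetSum _ fun i₁ _ => continuous_finsetSum _ fun i₂ _ =>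
    continuous_finsetSum _ fun μ _ => ?_
  exact continuous_const.mul ((hX _ _).mul (hX _ _))

/-- The drive is continuous on a time set on which all coefficients are. [folklore] -/
theorem quadTerm_continuousOn (α : Fin m → Fin m → Fin m → ℤ × ℤ × ℤ → ℝ) {X : Fin m → ℤ → ℝ → ℝ}
    {I : Set ℝ} (hX : ∀ j k, ContinuousOn (X j k) I) (i : Fin m) (n : ℤ) :
    ContinuousOn (fun s => quadTerm ε₀ α X i n s) I := by
  unfold quadTerm
  refine continuousOn_finsetSum _ fun i₁ _ => continuousOn_finsetSum _ fun i₂ _ =>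
    continuousOn_finsetSum _ fun μ _ => ?_
  exact continuousOn_const.mul ((hX _ _).mul (hX _ _))


/-- The coefficient sum of one output mode is at most the total coefficient sum `K = Σ|α|`. [folklore] -/
theorem coeffSum_le (α : Fin m → Fin m → Fin m → ℤ × ℤ × ℤ → ℝ) (i : Fin m) :
    (∑ i₁ : Fin m, ∑ i₂ : Fin m, ∑ μ ∈ shiftSet, |α i₁ i₂ i μ|) ≤
      ∑ i₃ : Fin m, ∑ i₁ : Fin m, ∑ i₂ : Fin m, ∑ μ ∈ shiftSet, |α i₁ i₂ i₃ μ| :=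
  Finset.single_le_sum (f := fun i₃ => ∑ i₁ : Fin m, ∑ i₂ : Fin m, ∑ μ ∈ shiftSet, |α i₁ i₂ i₃ μ|)
    (fun _ _ => by positivity) (Finset.mem_univ i)

/-! ### The Volterra operator in the weight `(1+ε₀)^{20n}` -/

/-- **Lipschitz bound for the Volterra term of scale `n ≥ n₀` in the weight `(1+ε₀)^{20n}`**: for two
continuous families of weighted size `ρ` at weighted distance `D`, a continuous kernel `|g| ≤ 1` and
`a ≤ t ≤ a + δ`,
`(1+ε₀)^{20n} |∫ₐᵗ g quadTerm_{i,n}(X) - ∫ₐᵗ g quadTerm_{i,n}(X')| ≤ δ (2Kρ (1+ε₀)^{75/2-35n₀/2}) D`. [cite: Tao2016AveragedNS, §4 p. 22 (4.14)] -/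
theorem weighted_volterra_sub_le (hε₀ : 0 < ε₀) (α : Fin m → Fin m → Fin m → ℤ × ℤ × ℤ → ℝ) {ρ D : ℝ}
    (hρ : 0 ≤ ρ) (hD : 0 ≤ D) {X X' : Fin m → ℤ → ℝ → ℝ} (hXc : ∀ j k, Continuous (X j k))
    (hX'c : ∀ j k, Continuous (X' j k))
    (hX : ∀ (j : Fin m) (k : ℤ) (s : ℝ), |X j k s| ≤ ρ * (1 + ε₀) ^ (-((20 : ℝ) * k)))
    (hX' : ∀ (j : Fin m) (k : ℤ) (s : ℝ), |X' j k s| ≤ ρ * (1 + ε₀) ^ (-((20 : ℝ) * k)))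
    (hd : ∀ (j : Fin m) (k : ℤ) (s : ℝ), |X j k s - X' j k s| ≤ D * (1 + ε₀) ^ (-((20 : ℝ) * k)))
    {g : ℝ → ℝ} (hgc : Continuous g) (hg : ∀ s, |g s| ≤ 1) {n₀ : ℤ} (i : Fin m) {n : ℤ} (hn : n₀ ≤ n)
    {a t δ : ℝ} (hat : a ≤ t) (htδ : t - a ≤ δ) :
    (1 + ε₀) ^ ((20 : ℝ) * n) *
        |(∫ s in a..t, g s * quadTerm ε₀ α X i n s) - ∫ s in a..t, g s * quadTerm ε₀ α X' i n s| ≤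
      δ * ((∑ i₃ : Fin m, ∑ i₁ : Fin m, ∑ i₂ : Fin m, ∑ μ ∈ shiftSet, |α i₁ i₂ i₃ μ|) * (2 * ρ) *
        (1 + ε₀) ^ ((75 : ℝ) / 2 - (35 : ℝ) / 2 * n₀)) * D := by
  have hL0 : 0 < 1 + ε₀ := by linarith
  have hL1 : 1 ≤ 1 + ε₀ := by linarith
  have hKi := coeffSum_le α i
  have hI : ∀ {Z : Fin m → ℤ → ℝ → ℝ}, (∀ j k, Continuous (Z j k)) →
      IntervalIntegrable (fun s => g s * quadTerm ε₀ α Z i n s) volume a t := fun hZ =>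
    (hgc.mul (continuous_quadTerm α hZ i n)).intervalIntegrable a t
  rw [← intervalIntegral.integral_sub (hI hXc) (hI hX'c)]
  have hint := intervalIntegral.norm_integral_le_of_norm_le_const (a := a) (b := t)
    (C := (∑ i₁ : Fin m, ∑ i₂ : Fin m, ∑ μ ∈ shiftSet, |α i₁ i₂ i μ|) * (2 * ρ * D) *
      (1 + ε₀) ^ ((2 * (20 : ℝ) - 5 / 2) * (1 - n)))
    (f := fun s => g s * quadTerm ε₀ α X i n s - g s * quadTerm ε₀ α X' i n s) fun s _ => by
      rw [Real.norm_eq_abs, ← mul_sub, abs_mul]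
      calc |g s| * |quadTerm ε₀ α X i n s - quadTerm ε₀ α X' i n s|
          ≤ 1 * ((∑ i₁ : Fin m, ∑ i₂ : Fin m, ∑ μ ∈ shiftSet, |α i₁ i₂ i μ|) * (2 * ρ * D) *
              (1 + ε₀) ^ ((2 * (20 : ℝ) - 5 / 2) * (1 - n))) :=
            mul_le_mul (hg s) (abs_quadTerm_sub_le_of_weight hε₀ (by norm_num) α hρ hD
              (fun j k => hX j k s) (fun j k => hX' j k s) (fun j k => hd j k s) i n)
              (abs_nonneg _) zero_le_one
        _ = _ := one_mul _
  rw [Real.norm_eq_abs, abs_of_nonneg (sub_nonneg.2 hat)] at hint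
  have hexp : (1 + ε₀) ^ ((20 : ℝ) * n) * (1 + ε₀) ^ ((2 * (20 : ℝ) - 5 / 2) * (1 - n)) ≤
      (1 + ε₀) ^ ((75 : ℝ) / 2 - (35 : ℝ) / 2 * n₀) := by
    rw [← Real.rpow_add hL0]
    refine Real.rpow_le_rpow_of_exponent_le hL1 ?_
    have hn' : (n₀ : ℝ) ≤ n := by exact_mod_cast hn
    linarith
  calc (1 + ε₀) ^ ((20 : ℝ) * n) *
        |∫ s in a..t, g s * quadTerm ε₀ α X i n s - g s * quadTerm ε₀ α X' i n s|
      ≤ (1 + ε₀) ^ ((20 : ℝ) * n) * ((∑ i₁ : Fin m, ∑ i₂ : Fin m, ∑ μ ∈ shiftSet, |α i₁ i₂ i μ|) *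
          (2 * ρ * D) * (1 + ε₀) ^ ((2 * (20 : ℝ) - 5 / 2) * (1 - n)) * (t - a)) :=
        mul_le_mul_of_nonneg_left hint (Real.rpow_nonneg hL0.le _)
    _ = ((1 + ε₀) ^ ((20 : ℝ) * n) * (1 + ε₀) ^ ((2 * (20 : ℝ) - 5 / 2) * (1 - n))) *
          ((∑ i₁ : Fin m, ∑ i₂ : Fin m, ∑ μ ∈ shiftSet, |α i₁ i₂ i μ|) * (2 * ρ)) * (t - a) * D := by
        ring
    _ ≤ (1 + ε₀) ^ ((75 : ℝ) / 2 - (35 : ℝ) / 2 * n₀) *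
          ((∑ i₃ : Fin m, ∑ i₁ : Fin m, ∑ i₂ : Fin m, ∑ μ ∈ shiftSet, |α i₁ i₂ i₃ μ|) * (2 * ρ)) *
            δ * D := by
        gcongr
    _ = _ := by ring

/-- **The Volterra term of scale `n ≥ n₀` in the weight `(1+ε₀)^{20n}`**: for a continuous family of
weighted size `ρ` (weight `20`), a continuous kernel `|g| ≤ 1` and `a ≤ t ≤ a + δ`,
`(1+ε₀)^{20n} |∫ₐᵗ g(s) quadTerm_{i,n}(X)(s) ds| ≤ δ (2Kρ (1+ε₀)^{75/2 - 35n₀/2}) ρ`, `K = Σ|α|`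
(the previous bound against the zero family). [cite: Tao2016AveragedNS, §4 p. 22 (4.14)] -/
theorem weighted_volterra_abs_le (hε₀ : 0 < ε₀) (α : Fin m → Fin m → Fin m → ℤ × ℤ × ℤ → ℝ) {ρ : ℝ}
    (hρ : 0 ≤ ρ) {X : Fin m → ℤ → ℝ → ℝ} (hXc : ∀ j k, Continuous (X j k))
    (hX : ∀ (j : Fin m) (k : ℤ) (s : ℝ), |X j k s| ≤ ρ * (1 + ε₀) ^ (-((20 : ℝ) * k)))
    {g : ℝ → ℝ} (hgc : Continuous g) (hg : ∀ s, |g s| ≤ 1) {n₀ : ℤ} (i : Fin m) {n : ℤ} (hn : n₀ ≤ n)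
    {a t δ : ℝ} (hat : a ≤ t) (htδ : t - a ≤ δ) :
    (1 + ε₀) ^ ((20 : ℝ) * n) * |∫ s in a..t, g s * quadTerm ε₀ α X i n s| ≤
      δ * ((∑ i₃ : Fin m, ∑ i₁ : Fin m, ∑ i₂ : Fin m, ∑ μ ∈ shiftSet, |α i₁ i₂ i₃ μ|) * (2 * ρ) *
        (1 + ε₀) ^ ((75 : ℝ) / 2 - (35 : ℝ) / 2 * n₀)) * ρ := by
  have hL0 : 0 < 1 + ε₀ := by linarith
  have h := weighted_volterra_sub_le hε₀ α hρ hρ hXc (X' := fun _ _ _ => 0) (fun _ _ => continuous_const)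
    hX (fun j k s => by rw [abs_zero]; positivity) (fun j k s => by rw [sub_zero]; exact hX j k s) hgc hg
    i hn hat htδ
  have h0 : (fun s => g s * quadTerm ε₀ α (fun _ _ _ => (0 : ℝ)) i n s) = fun _ => 0 := by
    funext s
    simp [quadTerm]
  rwa [h0, intervalIntegral.integral_zero, sub_zero] at h

/-! ### The weight bootstrap -/

/-- **Weight bootstrap for bounded solutions of the Volterra chain** (registered sub-goal
`stub_chainContinuationBootstrap` of the stub `chainContinuation`): let `Y` solve the chain
`Y_{i,n}(t) = A 1_{(i,n)=(i₀,n₀)} k_{i,n}(t) + ∫₀ᵗ k_{i,n}(t-s) quadTerm(Y)_{i,n}(s) ds` on `[0,S)` with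
kernels `|k_{i,n}| ≤ 1` and no modes below `n₀`. If `(1+ε₀)^{wn}|Y_{i,n}(t)| ≤ C` on `[0,S)`
(`w ≥ 5/4`) then `(1+ε₀)^{w'n}|Y_{i,n}(t)| ≤ C'` on `[0,S)` for every `w' ≤ 2w - 5/2`: the drive of
scale `n` has size `K C² (1+ε₀)^{(2w-5/2)(1-n)}`, `|k| ≤ 1`, and `t < S`. [cite: Tao2016AveragedNS, §4 p. 22 (4.14)] -/
theorem stub_chainContinuationBootstrap :
    ∀ {ε₀ : ℝ}, 0 < ε₀ → ∀ {m : ℕ} (α : Fin m → Fin m → Fin m → ℤ × ℤ × ℤ → ℝ)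
      (k : Fin m → ℤ → ℝ → ℝ) (i₀ : Fin m) (n₀ : ℤ) (A S : ℝ) (Y : Fin m → ℤ → ℝ → ℝ) (w w' C : ℝ),
      5 / 4 ≤ w → w' ≤ 2 * w - 5 / 2 →
      (∀ i n τ, |k i n τ| ≤ 1) →
      (∀ i n t, n < n₀ → Y i n t = 0) →
      (∀ (i : Fin m) (n : ℤ), ∀ t ∈ Ico 0 S,
        Y i n t = (if i = i₀ ∧ n = n₀ then A else 0) * k i n t +
          ∫ s in (0 : ℝ)..t, k i n (t - s) * quadTerm ε₀ α Y i n s) →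
      (∀ (i : Fin m) (n : ℤ), ∀ t ∈ Ico 0 S, (1 + ε₀) ^ (w * n) * |Y i n t| ≤ C) →
      ∃ C' : ℝ, ∀ (i : Fin m) (n : ℤ), ∀ t ∈ Ico 0 S, (1 + ε₀) ^ (w' * n) * |Y i n t| ≤ C' := by
  intro ε₀ hε₀ m α k i₀ n₀ A S Y w w' C hw hw' hk hlow hchain hC
  have hL0 : 0 < 1 + ε₀ := by linarith
  have hL1 : 1 ≤ 1 + ε₀ := by linarith
  rcases le_or_gt S 0 with hS | hS
  · exact ⟨0, fun i n t ht => absurd (ht.1.trans_lt ht.2) (not_lt.2 hS)⟩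
  have hC0 : 0 ≤ C :=
    le_trans (mul_nonneg (Real.rpow_nonneg hL0.le _) (abs_nonneg _)) (hC i₀ n₀ 0 ⟨le_rfl, hS⟩)
  have hY : ∀ s ∈ Ico 0 S, ∀ (j : Fin m) (k' : ℤ), |Y j k' s| ≤ C * (1 + ε₀) ^ (-(w * k')) :=
    fun s hs j k' => (weight_mul_abs_le_iff hL0 _ _ _).1 (hC j k' s hs)
  set K : ℝ := ∑ i₃ : Fin m, ∑ i₁ : Fin m, ∑ i₂ : Fin m, ∑ μ ∈ shiftSet, |α i₁ i₂ i₃ μ| with hK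
  have hK0 : 0 ≤ K := by positivity
  have hKall : ∀ i : Fin m, (∑ i₁ : Fin m, ∑ i₂ : Fin m, ∑ μ ∈ shiftSet, |α i₁ i₂ i μ|) ≤ K :=
    fun i => coeffSum_le α i
  clear_value K
  refine ⟨(1 + ε₀) ^ (w' * n₀) * |A| +
    S * (K * (2 * C * C) * (1 + ε₀) ^ ((2 * w - 5 / 2) + (w' - (2 * w - 5 / 2)) * n₀)),
    fun i n t ht => ?_⟩
  rcases lt_or_ge n n₀ with hn | hn
  · rw [hlow i n t hn, abs_zero, mul_zero]
    positivity
  have hKi := hKall i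
  have h1 : (1 + ε₀) ^ (w' * n) * |(if i = i₀ ∧ n = n₀ then A else 0) * k i n t| ≤
      (1 + ε₀) ^ (w' * n₀) * |A| := by
    split_ifs with h
    · rw [abs_mul, h.2]
      calc (1 + ε₀) ^ (w' * n₀) * (|A| * |k i n₀ t|) ≤ (1 + ε₀) ^ (w' * n₀) * (|A| * 1) := by
            gcongr
            exact hk i n₀ t
        _ = _ := by ring
    · rw [zero_mul, abs_zero, mul_zero]
      positivity
  have hint := intervalIntegral.norm_integral_le_of_norm_le_const (a := 0) (b := t)
    (C := (∑ i₁ : Fin m, ∑ i₂ : Fin m, ∑ μ ∈ shiftSet, |α i₁ i₂ i μ|) * (2 * C * C) *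
      (1 + ε₀) ^ ((2 * w - 5 / 2) * (1 - n)))
    (f := fun s => k i n (t - s) * quadTerm ε₀ α Y i n s) fun s hs => by
      rw [uIoc_of_le ht.1] at hs
      rw [Real.norm_eq_abs, abs_mul]
      calc |k i n (t - s)| * |quadTerm ε₀ α Y i n s|
          ≤ 1 * ((∑ i₁ : Fin m, ∑ i₂ : Fin m, ∑ μ ∈ shiftSet, |α i₁ i₂ i μ|) * (2 * C * C) *
              (1 + ε₀) ^ ((2 * w - 5 / 2) * (1 - n))) :=
            mul_le_mul (hk _ _ _) (abs_quadTerm_le_of_weight hε₀ hw α hC0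
              (hY s ⟨hs.1.le, hs.2.trans_lt ht.2⟩) i n) (abs_nonneg _) zero_le_one
        _ = _ := one_mul _
  rw [Real.norm_eq_abs, sub_zero, abs_of_nonneg ht.1] at hint
  have hexp : (1 + ε₀) ^ (w' * n) * (1 + ε₀) ^ ((2 * w - 5 / 2) * (1 - n)) ≤
      (1 + ε₀) ^ ((2 * w - 5 / 2) + (w' - (2 * w - 5 / 2)) * n₀) := by
    rw [← Real.rpow_add hL0]
    refine Real.rpow_le_rpow_of_exponent_le hL1 ?_
    have hn' : (n₀ : ℝ) ≤ n := by exact_mod_cast hn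
    nlinarith [mul_le_mul_of_nonpos_left hn' (sub_nonpos.2 hw')]
  have h2 : (1 + ε₀) ^ (w' * n) * |∫ s in (0 : ℝ)..t, k i n (t - s) * quadTerm ε₀ α Y i n s| ≤
      S * (K * (2 * C * C) * (1 + ε₀) ^ ((2 * w - 5 / 2) + (w' - (2 * w - 5 / 2)) * n₀)) := by
    calc (1 + ε₀) ^ (w' * n) * |∫ s in (0 : ℝ)..t, k i n (t - s) * quadTerm ε₀ α Y i n s|
        ≤ (1 + ε₀) ^ (w' * n) * ((∑ i₁ : Fin m, ∑ i₂ : Fin m, ∑ μ ∈ shiftSet, |α i₁ i₂ i μ|) * (2 * C * C) *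
            (1 + ε₀) ^ ((2 * w - 5 / 2) * (1 - n)) * t) :=
          mul_le_mul_of_nonneg_left hint (Real.rpow_nonneg hL0.le _)
      _ = ((1 + ε₀) ^ (w' * n) * (1 + ε₀) ^ ((2 * w - 5 / 2) * (1 - n))) *
            ((∑ i₁ : Fin m, ∑ i₂ : Fin m, ∑ μ ∈ shiftSet, |α i₁ i₂ i μ|) * (2 * C * C)) * t := by ring
      _ ≤ (1 + ε₀) ^ ((2 * w - 5 / 2) + (w' - (2 * w - 5 / 2)) * n₀) * (K * (2 * C * C)) * S :=
          mul_le_mul (mul_le_mul hexp (mul_le_mul_of_nonneg_right hKi (by positivity)) (by positivity)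
            (Real.rpow_nonneg hL0.le _)) ht.2.le ht.1 (by positivity)
      _ = _ := by ring
  rw [hchain i n t ht]
  calc (1 + ε₀) ^ (w' * n) * |(if i = i₀ ∧ n = n₀ then A else 0) * k i n t +
        ∫ s in (0 : ℝ)..t, k i n (t - s) * quadTerm ε₀ α Y i n s|
      ≤ (1 + ε₀) ^ (w' * n) * (|(if i = i₀ ∧ n = n₀ then A else 0) * k i n t| +
          |∫ s in (0 : ℝ)..t, k i n (t - s) * quadTerm ε₀ α Y i n s|) :=
        mul_le_mul_of_nonneg_left (abs_add_le _ _) (Real.rpow_nonneg hL0.le _)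
    _ ≤ _ := by rw [mul_add]; exact add_le_add h1 h2

end Summit.NavierStokesRegularity.NavierStokesRegularity.Theorems.PerpetualPumpAveragedTypeIBlowup

end
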